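import Summits.Ventures.HSemireg.ContractionSpanKunneth
import Mathlib.LinearAlgebra.LinearDisjoint
import Mathlib.LinearAlgebra.ExteriorAlgebra.Basis
import Mathlib.LinearAlgebra.TensorProduct.Submodule
import Mathlib.Data.Fin.Embedding
import Mathlib.LinearAlgebra.Basis.VectorSpace
import HarnessLib

/-!
# Venture HSemireg — Künneth structure of the polyvector contraction span, III: the count
# `dim span(x₁ ∧ x₂) = r₂(x₁)·r₀(x₂) + r₁(x₁)·r₁(x₂) + r₀(x₁)·r₂(x₂)` (th-7's K_lin at degree 2: «rank polynomials
# multiply», literal contraction frame), via the LINEAR DISJOINTNESS of `Λ V₁` and `Λ V₂` in `Λ(V₁ ⊕ V₂)`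

HONEST FRAMING. Pure linear algebra, continuing `ContractionSpanFactor.lean` / `ContractionSpanKunneth.lean` (seat p4 of the
computation cell `pub-hsemireg`; statement sheet `theory/FORMULA-N-th7.md` §N.3 / §N.5, theory seat 7). Nothing here is a
claim about any variety and nothing here says that HC / HC_CM / HC_AV holds. Everything is PROVED; no named fact.

CONTENT. §1 An abstract KÜNNETH COUNT in any algebra `S` over a field: if `A, B ⊆ S` are linearly disjoint subspaces
(Mathlib's `Submodule.LinearDisjoint`: `A ⊗ B → S` injective), `Uᵢ ⊆ A` are independent and `Wᵢ ⊆ B` are independent, then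
`dim (Σᵢ Uᵢ·Wᵢ) = Σᵢ dim Uᵢ · dim Wᵢ` (`finrank_iSup_mul_eq_sum`; products of independent families are independent,
Mathlib's `LinearDisjoint.linearIndependent_mul_of_flat`). §2 `Λ V₁` and `Λ V₂` ARE linearly disjoint in `Λ V` for
`V = V₁ ⊕ V₂` (`linearDisjoint_factorAlg`): with a basis of `V` adapted to the splitting, `Λ Vᵢ` is the span of the
monomials supported on block `i` (`factorAlg_eq_span_monomials`) and products of monomials on disjoint blocks are `±`
distinct basis monomials of Mathlib's `Basis.ExteriorAlgebra` (`linearDisjoint_span_monomials`; the sign is a unit and is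
never evaluated). §3 THE COUNT `finrank_span_mul_eq` for the product formula of `ContractionSpanKunneth.lean`: for even
factor classes whose three factor spans `K xᵢ, S¹(xᵢ), S²(xᵢ)` are independent (e.g. by degree),
`dim span(x₁ ∧ x₂) = dim S²(x₁)·dim K x₂ + dim S¹(x₁)·dim S¹(x₂) + dim K x₁·dim S²(x₂)`. The point-pair box
(`2·r₂(n) + r₁(n)² = 6n² - 2n`, `18` at `n = 2`) and the real-carrier corollary are the sequel.

References: [BourbakiAlgebre1a3] Ch. III §7 no. 7–8 (`Λ(M ⊕ N) ≅ Λ M ⊗ Λ N`, bases of `Λ M`), Ch. II §7 no. 7 (dimension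
of a tensor product); [BuchweitzFlenner2008HH] Prop. 6.4.4.
-/

noncomputable section

open CliffordAlgebra (contractLeft)
open ExteriorAlgebra (ι)
open Module

namespace Summit.Ventures.HSemireg

namespace ContractionSpan

/-! ### 1. The abstract Künneth count -/

section Module

variable {K : Type*} [Field K] {M : Type*} [AddCommGroup M] [Module K M]

/-- The span of (the ambient images of) a basis of a subspace is the subspace. [cite: BourbakiAlgebre1a3, Ch. II §1 no. 11] -/
theorem span_range_basis_coe (U : Submodule K M) {β : Type*} (b : Basis β K U) :
    Submodule.span K (Set.range fun i => (b i : M)) = U := by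
  rw [show (fun i => (b i : M)) = U.subtype ∘ b from rfl, Set.range_comp, Submodule.span_image, b.span_eq,
    Submodule.map_top, Submodule.range_subtype]

/-- Bases of INDEPENDENT subspaces combine to a linearly independent family.
[cite: BourbakiAlgebre1a3, Ch. II §1 no. 11] -/
theorem linearIndependent_sigma_basis {ι' : Type*} {β : ι' → Type*} (U : ι' → Submodule K M) (hU : iSupIndep U)
    (b : ∀ i, Basis (β i) K (U i)) : LinearIndependent K fun p : (Σ i, β i) => (b p.1 p.2 : M) := by
  apply linearIndependent_iUnion_finite (f := fun i a => (b i a : M))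
  · intro i
    exact (b i).linearIndependent.map' (U i).subtype (Submodule.ker_subtype _)
  · intro i t _ hit
    simp_rw [span_range_basis_coe]
    exact hU.disjoint_biSup hit

end Module

section Count

variable {K : Type*} [Field K] {S : Type*} [Ring S] [Algebra K S]

/-- **Products of bases of independent families inside linearly disjoint subspaces are linearly independent**: for
`A, B ⊆ S` linearly disjoint, `Uᵢ ⊆ A` independent with bases `bUᵢ` and `Wᵢ ⊆ B` independent with bases `bWᵢ`, the
products `bUᵢ(a) · bWᵢ(c)` (same `i`) are linearly independent (Mathlib's `LinearDisjoint.linearIndependent_mul_of_flat`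
on the combined families, restricted to the diagonal). [cite: BourbakiAlgebre1a3, Ch. II §7 no. 7 and Ch. III §7 no. 7] -/
theorem linearIndependent_mul_sigma {A B : Submodule K S} (hAB : A.LinearDisjoint B) {ι' : Type*} {β γ : ι' → Type*}
    {U W : ι' → Submodule K S} (hUA : ∀ i, U i ≤ A) (hWB : ∀ i, W i ≤ B) (hU : iSupIndep U) (hW : iSupIndep W)
    (bU : ∀ i, Basis (β i) K (U i)) (bW : ∀ i, Basis (γ i) K (W i)) :
    LinearIndependent K fun p : (Σ i, β i × γ i) => (bU p.1 p.2.1 : S) * (bW p.1 p.2.2 : S) := by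
  -- the combined families, lifted into `A` and `B`
  have huA : LinearIndependent K fun p : (Σ i, β i) => (⟨(bU p.1 p.2 : S), hUA p.1 (bU p.1 p.2).2⟩ : A) :=
    LinearIndependent.of_comp A.subtype (linearIndependent_sigma_basis U hU bU)
  have hwB : LinearIndependent K fun p : (Σ i, γ i) => (⟨(bW p.1 p.2 : S), hWB p.1 (bW p.1 p.2).2⟩ : B) :=
    LinearIndependent.of_comp B.subtype (linearIndependent_sigma_basis W hW bW)
  -- all products are linearly independent (linear disjointness); restrict to the diagonal `i = i`
  have H := hAB.linearIndependent_mul_of_flat (Or.inl inferInstance) huA hwB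
  have hinj : Function.Injective (fun p : (Σ i, β i × γ i) => ((⟨p.1, p.2.1⟩ : Σ i, β i), (⟨p.1, p.2.2⟩ : Σ i, γ i))) := by
    rintro ⟨i, a, c⟩ ⟨j, a', c'⟩ h
    simp only [Prod.mk.injEq, Sigma.mk.inj_iff] at h
    obtain ⟨⟨rfl, ha⟩, -, hc⟩ := h
    rw [heq_iff_eq] at ha hc
    subst ha
    subst hc
    rfl
  have hF := H.comp _ hinj
  exact hF

/-- The span of those products is `Σᵢ Uᵢ · Wᵢ`. [cite: BourbakiAlgebre1a3, Ch. III §7 no. 7] -/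
theorem span_range_mul_sigma {ι' : Type*} {β γ : ι' → Type*} {U W : ι' → Submodule K S} (bU : ∀ i, Basis (β i) K (U i))
    (bW : ∀ i, Basis (γ i) K (W i)) :
    Submodule.span K (Set.range fun p : (Σ i, β i × γ i) => (bU p.1 p.2.1 : S) * (bW p.1 p.2.2 : S)) = ⨆ i, U i * W i := by
  rw [Set.range_sigma_eq_iUnion_range, Submodule.span_iUnion]
  refine iSup_congr fun i => ?_
  show Submodule.span K (Set.range fun ac : β i × γ i => (bU i ac.1 : S) * (bW i ac.2 : S)) = U i * W i
  rw [← Set.image2_range (· * ·) (fun a => (bU i a : S)) (fun c => (bW i c : S)), Set.image2_mul,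
    ← Submodule.span_mul_span, span_range_basis_coe, span_range_basis_coe]

/-- **The abstract Künneth count.** In an algebra `S` over a field, let `A, B` be linearly disjoint subspaces, `Uᵢ ⊆ A` an
independent finite family of finite-dimensional subspaces and `Wᵢ ⊆ B` likewise. Then
`dim (Σᵢ Uᵢ · Wᵢ) = Σᵢ dim Uᵢ · dim Wᵢ` (the products of basis vectors form a basis of the left side).
[cite: BourbakiAlgebre1a3, Ch. II §7 no. 7 and Ch. III §7 no. 7] -/
theorem finrank_iSup_mul_eq_sum {A B : Submodule K S} (hAB : A.LinearDisjoint B) {ι' : Type*} [Fintype ι']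
    {U W : ι' → Submodule K S} (hUA : ∀ i, U i ≤ A) (hWB : ∀ i, W i ≤ B) (hU : iSupIndep U) (hW : iSupIndep W)
    [∀ i, FiniteDimensional K (U i)] [∀ i, FiniteDimensional K (W i)] :
    Module.finrank K (⨆ i, U i * W i : Submodule K S) = ∑ i, Module.finrank K (U i) * Module.finrank K (W i) := by
  rw [← span_range_mul_sigma (fun i => Module.finBasis K (U i)) (fun i => Module.finBasis K (W i)),
    finrank_span_eq_card (linearIndependent_mul_sigma hAB hUA hWB hU hW (fun i => Module.finBasis K (U i))
      (fun i => Module.finBasis K (W i))), Fintype.card_sigma]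
  simp only [Fintype.card_prod, Fintype.card_fin]

end Count

/-! ### 2. `Λ V₁` and `Λ V₂` are linearly disjoint in `Λ(V₁ ⊕ V₂)` -/

section Disjoint

variable {K : Type*} [Field K] {V : Type*} [AddCommGroup V] [Module K V]

/-- The empty monomial is `1`. [cite: BourbakiAlgebre1a3, Ch. III §7 no. 8] -/
theorem basis_exteriorAlgebra_empty {N : ℕ} (b : Basis (Fin N) K V) : b.ExteriorAlgebra ∅ = 1 := by
  rw [ExteriorAlgebra.basis_apply_ofCard b Finset.card_empty]
  exact ExteriorAlgebra.ιMulti_zero_apply _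

/-- The singleton monomial is the basis vector. [cite: BourbakiAlgebre1a3, Ch. III §7 no. 8] -/
theorem basis_exteriorAlgebra_singleton {N : ℕ} (b : Basis (Fin N) K V) (j : Fin N) : b.ExteriorAlgebra {j} = ι K (b j) := by
  rw [ExteriorAlgebra.basis_apply_ofCard b (Finset.card_singleton j)]
  dsimp only [ExteriorAlgebra.ιMulti_family]
  rw [ExteriorAlgebra.ιMulti_succ_apply, ExteriorAlgebra.ιMulti_zero_apply, mul_one, Function.comp_apply,
    Set.powersetCard.ofFinEmbEquiv_symm_apply]
  simp only [Set.powersetCard.val_ofCard, Finset.orderEmbOfFin_singleton]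

/-- A ±1 of `ℤ` is nonzero in a field. [folklore] -/
theorem intUnits_cast_ne_zero (x : ℤˣ) : ((x : ℤ) : K) ≠ 0 := by
  rcases Int.units_eq_one_or x with rfl | rfl <;> simp

/-- **`Λ W` is the span of the monomials supported on the block of `W`**: for a basis `b` of `V` and a block `φ` of
indices with `W = span(b ∘ φ)`, the subalgebra generated by `W` is spanned by the `b.ExteriorAlgebra (s.map φ)`.
[cite: BourbakiAlgebre1a3, Ch. III §7 no. 8 (Thm. 1)] -/
theorem factorAlg_eq_span_monomials {N m : ℕ} (b : Basis (Fin N) K V) (φ : Fin m ↪ Fin N) {W : Submodule K V}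
    (hbW : ∀ i, b (φ i) ∈ W) (hW : W ≤ Submodule.span K (Set.range fun i => b (φ i))) :
    Subalgebra.toSubmodule (factorAlg W) =
      Submodule.span K (Set.range fun s : Finset (Fin m) => b.ExteriorAlgebra (s.map φ)) := by
  classical
  apply le_antisymm
  · -- `adjoin ≤`: the span of the block monomials is a subalgebra containing `ι(W)`
    have h1 : (1 : ExteriorAlgebra K V) ∈ Submodule.span K (Set.range fun s : Finset (Fin m) => b.ExteriorAlgebra (s.map φ)) := by
      refine Submodule.subset_span ⟨∅, ?_⟩
      dsimp only
      rw [Finset.map_empty, basis_exteriorAlgebra_empty]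
    have hmul : ∀ x y, x ∈ Submodule.span K (Set.range fun s : Finset (Fin m) => b.ExteriorAlgebra (s.map φ)) →
        y ∈ Submodule.span K (Set.range fun s : Finset (Fin m) => b.ExteriorAlgebra (s.map φ)) →
        x * y ∈ Submodule.span K (Set.range fun s : Finset (Fin m) => b.ExteriorAlgebra (s.map φ)) := by
      intro x y hx hy
      have hxy := Submodule.mul_mem_mul hx hy
      rw [Submodule.span_mul_span] at hxy
      refine (Submodule.span_le.mpr ?_) hxy
      rintro _ ⟨_, ⟨s, rfl⟩, _, ⟨t, rfl⟩, rfl⟩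
      dsimp only
      by_cases h : Disjoint (s.map φ) (t.map φ)
      · have h2 := ExteriorAlgebra.basis_mul_of_disjoint b (Set.powersetCard.ofCard (s := s.map φ) rfl)
          (Set.powersetCard.ofCard (s := t.map φ) rfl) h
        simp only [Set.powersetCard.val_ofCard, Set.powersetCard.coe_disjUnion, Finset.disjUnion_eq_union,
          ← Finset.map_union] at h2
        rw [SetLike.mem_coe, h2, Units.smul_def]
        have hm : b.ExteriorAlgebra ((s ∪ t).map φ) ∈
            Submodule.span K (Set.range fun s : Finset (Fin m) => b.ExteriorAlgebra (s.map φ)) :=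
          Submodule.subset_span (Set.mem_range_self (f := fun s : Finset (Fin m) => b.ExteriorAlgebra (s.map φ)) (s ∪ t))
        exact zsmul_mem hm _
      · have h2 := ExteriorAlgebra.basis_mul_of_not_disjoint b (Set.powersetCard.ofCard (s := s.map φ) rfl)
          (Set.powersetCard.ofCard (s := t.map φ) rfl) h
        simp only [Set.powersetCard.val_ofCard] at h2
        rw [SetLike.mem_coe, h2]
        exact Submodule.zero_mem _
    have hle : factorAlg W ≤ (Submodule.span K (Set.range fun s : Finset (Fin m) => b.ExteriorAlgebra (s.map φ))).toSubalgebra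
        h1 hmul := by
      refine Algebra.adjoin_le ?_
      rintro _ ⟨v, hv, rfl⟩
      rw [SetLike.mem_coe, Submodule.mem_toSubalgebra]
      have hv' : ι K v ∈ (Submodule.span K (Set.range fun i => b (φ i))).map (ι K) := Submodule.mem_map_of_mem (hW hv)
      rw [Submodule.map_span] at hv'
      refine (Submodule.span_le.mpr ?_) hv'
      rintro _ ⟨_, ⟨i, rfl⟩, rfl⟩
      rw [SetLike.mem_coe, ← basis_exteriorAlgebra_singleton]
      refine Submodule.subset_span ⟨{i}, ?_⟩
      dsimp only
      rw [Finset.map_singleton]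
    intro x hx
    exact Submodule.mem_toSubalgebra.mp (hle hx)
  · refine Submodule.span_le.mpr ?_
    rintro _ ⟨s, rfl⟩
    dsimp only
    rw [SetLike.mem_coe, Subalgebra.mem_toSubmodule, ExteriorAlgebra.basis_apply_ofCard b (rfl : (s.map φ).card = _)]
    dsimp only [ExteriorAlgebra.ιMulti_family]
    rw [ExteriorAlgebra.ιMulti_apply]
    refine Subalgebra.list_prod_mem _ ?_
    intro y hy
    obtain ⟨k, -, rfl⟩ := List.mem_ofFn.mp hy
    refine ι_mem_factorAlg ?_
    have hk : (Set.powersetCard.ofFinEmbEquiv.symm (Set.powersetCard.ofCard (rfl : (s.map φ).card = _))) k ∈ s.map φ :=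
      (Set.powersetCard.mem_range_ofFinEmbEquiv_symm_iff_mem _ _).mp ⟨k, rfl⟩
    obtain ⟨i, -, hi⟩ := Finset.mem_map.mp hk
    rw [Function.comp_apply, ← hi]
    exact hbW i

/-- **Products of monomials on DISJOINT blocks are linearly independent**, hence the spans of the two blocks' monomials are
linearly disjoint (the product of two monomials on disjoint index sets is `±` the monomial of the union).
[cite: BourbakiAlgebre1a3, Ch. III §7 no. 7–8] -/
theorem linearDisjoint_span_monomials {N m₁ m₂ : ℕ} (b : Basis (Fin N) K V) (φ₁ : Fin m₁ ↪ Fin N) (φ₂ : Fin m₂ ↪ Fin N)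
    (hφ : ∀ i j, φ₁ i ≠ φ₂ j) :
    (Submodule.span K (Set.range fun s : Finset (Fin m₁) => b.ExteriorAlgebra (s.map φ₁))).LinearDisjoint
      (Submodule.span K (Set.range fun t : Finset (Fin m₂) => b.ExteriorAlgebra (t.map φ₂))) := by
  classical
  have hli₁ : LinearIndependent K (fun s : Finset (Fin m₁) => b.ExteriorAlgebra (s.map φ₁)) :=
    b.ExteriorAlgebra.linearIndependent.comp _ (Finset.map_injective φ₁)
  have hli₂ : LinearIndependent K (fun t : Finset (Fin m₂) => b.ExteriorAlgebra (t.map φ₂)) :=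
    b.ExteriorAlgebra.linearIndependent.comp _ (Finset.map_injective φ₂)
  refine Submodule.LinearDisjoint.of_basis_mul _ _ (Basis.span hli₁) (Basis.span hli₂) ?_
  simp_rw [Basis.span_apply]
  -- the two blocks are disjoint, so `(s, t) ↦ s.map φ₁ ∪ t.map φ₂` is injective
  have hd : ∀ p : Finset (Fin m₁) × Finset (Fin m₂), Disjoint (p.1.map φ₁) (p.2.map φ₂) := fun p =>
    Finset.disjoint_left.mpr (by
      intro x hx₁ hx₂
      obtain ⟨i, -, rfl⟩ := Finset.mem_map.mp hx₁
      obtain ⟨j, -, hj⟩ := Finset.mem_map.mp hx₂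
      exact hφ i j hj.symm)
  have h1 : ∀ (q : Finset (Fin m₁) × Finset (Fin m₂)) i, φ₁ i ∈ q.1.map φ₁ ∪ q.2.map φ₂ ↔ i ∈ q.1 := fun q i => by
    rw [Finset.mem_union, Finset.mem_map' φ₁, or_iff_left]
    intro h2
    obtain ⟨j, -, hj⟩ := Finset.mem_map.mp h2
    exact hφ i j hj.symm
  have h2 : ∀ (q : Finset (Fin m₁) × Finset (Fin m₂)) j, φ₂ j ∈ q.1.map φ₁ ∪ q.2.map φ₂ ↔ j ∈ q.2 := fun q j => by
    rw [Finset.mem_union, Finset.mem_map' φ₂, or_iff_right]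
    intro h3
    obtain ⟨i, -, hi⟩ := Finset.mem_map.mp h3
    exact hφ i j hi
  have hu : Function.Injective (fun p : Finset (Fin m₁) × Finset (Fin m₂) => p.1.map φ₁ ∪ p.2.map φ₂) := by
    intro p p' h
    simp only at h
    exact Prod.ext (Finset.ext fun i => by rw [← h1 p, ← h1 p', h]) (Finset.ext fun j => by rw [← h2 p, ← h2 p', h])
  have hg : LinearIndependent K (fun p : Finset (Fin m₁) × Finset (Fin m₂) => b.ExteriorAlgebra (p.1.map φ₁ ∪ p.2.map φ₂)) :=
    b.ExteriorAlgebra.linearIndependent.comp _ hu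
  have key : ∀ p : Finset (Fin m₁) × Finset (Fin m₂), ∃ c : K, c ≠ 0 ∧
      b.ExteriorAlgebra (p.1.map φ₁) * b.ExteriorAlgebra (p.2.map φ₂) = c • b.ExteriorAlgebra (p.1.map φ₁ ∪ p.2.map φ₂) :=
    fun p => by
    have h3 := ExteriorAlgebra.basis_mul_of_disjoint b (Set.powersetCard.ofCard (s := p.1.map φ₁) rfl)
      (Set.powersetCard.ofCard (s := p.2.map φ₂) rfl) (hd p)
    simp only [Set.powersetCard.val_ofCard, Set.powersetCard.coe_disjUnion, Finset.disjUnion_eq_union] at h3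
    exact ⟨_, intUnits_cast_ne_zero (K := K) _, by rw [h3, Units.smul_def, ← Int.cast_smul_eq_zsmul K]⟩
  choose c hc0 hc using key
  have hw := hg.units_smul fun p => Units.mk0 (c p) (hc0 p)
  have hfun : (fun p : Finset (Fin m₁) × Finset (Fin m₂) => b.ExteriorAlgebra (p.1.map φ₁) * b.ExteriorAlgebra (p.2.map φ₂)) =
      (fun p => Units.mk0 (c p) (hc0 p)) •
        (fun p : Finset (Fin m₁) × Finset (Fin m₂) => b.ExteriorAlgebra (p.1.map φ₁ ∪ p.2.map φ₂)) := by
    funext p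
    rw [hc p, Pi.smul_apply', Units.smul_mk0]
  rw [hfun]
  exact hw

variable [FiniteDimensional K V] {V₁ V₂ : Submodule K V}

/-- **`Λ V₁` and `Λ V₂` are linearly disjoint in `Λ V` for `V = V₁ ⊕ V₂`** (`Λ(V₁ ⊕ V₂) ≅ Λ V₁ ⊗ Λ V₂`: the
multiplication `Λ V₁ ⊗ Λ V₂ → Λ V` is injective). [cite: BourbakiAlgebre1a3, Ch. III §7 no. 7 (Prop. 10)] -/
theorem linearDisjoint_factorAlg (hV : IsCompl V₁ V₂) :
    (Subalgebra.toSubmodule (factorAlg V₁)).LinearDisjoint (Subalgebra.toSubmodule (factorAlg V₂)) := by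
  -- a basis of `V` adapted to the splitting
  let b : Basis (Fin (Module.finrank K V₁ + Module.finrank K V₂)) K V :=
    (((Module.finBasis K V₁).prod (Module.finBasis K V₂)).map (Submodule.prodEquivOfIsCompl V₁ V₂ hV)).reindex
      finSumFinEquiv
  have hb₁ : ∀ i, b (Fin.castAddEmb _ i) = (Module.finBasis K V₁ i : V) := fun i => by
    simp only [b, Fin.castAddEmb_apply, Basis.reindex_apply, finSumFinEquiv_symm_apply_castAdd, Basis.map_apply,
      Basis.prod_apply, Sum.elim_inl, Function.comp_apply, LinearMap.inl_apply, Submodule.coe_prodEquivOfIsCompl',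
      Submodule.coe_zero, add_zero]
  have hb₂ : ∀ j, b (Fin.natAddEmb _ j) = (Module.finBasis K V₂ j : V) := fun j => by
    simp only [b, Fin.natAddEmb_apply, Basis.reindex_apply, finSumFinEquiv_symm_apply_natAdd, Basis.map_apply,
      Basis.prod_apply, Sum.elim_inr, Function.comp_apply, LinearMap.inr_apply, Submodule.coe_prodEquivOfIsCompl',
      Submodule.coe_zero, zero_add]
  have hW₁ : V₁ ≤ Submodule.span K (Set.range fun i => b (Fin.castAddEmb (Module.finrank K V₂) i)) := by
    simp_rw [hb₁]; exact (span_range_basis_coe V₁ (Module.finBasis K V₁)).ge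
  have hW₂ : V₂ ≤ Submodule.span K (Set.range fun j => b (Fin.natAddEmb (Module.finrank K V₁) j)) := by
    simp_rw [hb₂]; exact (span_range_basis_coe V₂ (Module.finBasis K V₂)).ge
  rw [factorAlg_eq_span_monomials b (Fin.castAddEmb _) (fun i => by rw [hb₁]; exact Submodule.coe_mem _) hW₁,
    factorAlg_eq_span_monomials b (Fin.natAddEmb _) (fun j => by rw [hb₂]; exact Submodule.coe_mem _) hW₂]
  refine linearDisjoint_span_monomials b _ _ fun i j h => ?_
  have h' := congrArg Fin.val h
  simp only [Fin.castAddEmb_apply, Fin.natAddEmb_apply, Fin.val_castAdd, Fin.val_natAdd] at h'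
  have := i.isLt
  omega

/-- `Λ V` is finite-dimensional for finite-dimensional `V` (a basis indexed by the finite subsets of a basis of `V`).
[cite: BourbakiAlgebre1a3, Ch. III §7 no. 8 (Thm. 1)] -/
theorem finiteDimensional_exteriorAlgebra : FiniteDimensional K (ExteriorAlgebra K V) :=
  Module.Finite.of_basis (Module.finBasis K V).ExteriorAlgebra

end Disjoint

/-! ### 3. The count for the product formula -/

section KunnethCount

variable {K : Type*} [Field K] {V : Type*} [AddCommGroup V] [Module K V]
  {V₁ V₂ L₁ L₂ : Submodule K V} {x₁ x₂ : ExteriorAlgebra K V}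

/-- The factor spans lie in the factor subalgebra: `K x ⊆ Λ W`. [cite: BourbakiAlgebre1a3, Ch. III §7 no. 7] -/
theorem span_singleton_le_factorAlg {W : Submodule K V} {x : ExteriorAlgebra K V} (hx : x ∈ evenFactorAlg W) :
    (K ∙ x) ≤ Subalgebra.toSubmodule (factorAlg W) :=
  (Submodule.span_singleton_le_iff_mem _ _).mpr (evenFactorAlg_le hx)

/-- The degree-one span of `x ∈ Λ^{even} W` with respect to `L ⊆ W` lies in `Λ W`.
[cite: BourbakiAlgebre1a3, Ch. III §7 no. 7 and §11 no. 9] -/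
theorem span₁_le_factorAlg {L W W' : Submodule K V} (hL : L ≤ W) {x : ExteriorAlgebra K V} (hx : x ∈ evenFactorAlg W) :
    span₁ (L : Set V) (factorForms L W') x ≤ Subalgebra.toSubmodule (factorAlg W) := by
  refine Submodule.span_le.mpr ?_
  rintro y (⟨q, hq, rfl⟩ | ⟨θ, -, rfl⟩)
  · exact Subalgebra.mul_mem _ (ι_mem_factorAlg (hL hq)) (evenFactorAlg_le hx)
  · exact contractLeft_mem_factorAlg θ (evenFactorAlg_le hx)

/-- The degree-two span of `x ∈ Λ^{even} W` with respect to `L ⊆ W` lies in `Λ W`.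
[cite: BourbakiAlgebre1a3, Ch. III §7 no. 7 and §11 no. 9] -/
theorem span_le_factorAlg {L W W' : Submodule K V} (hL : L ≤ W) {x : ExteriorAlgebra K V} (hx : x ∈ evenFactorAlg W) :
    span (L : Set V) (factorForms L W') x ≤ Subalgebra.toSubmodule (factorAlg W) := by
  refine Submodule.span_le.mpr ?_
  rintro y ((⟨q, hq, q', hq', rfl⟩ | ⟨q, hq, θ, -, rfl⟩) | ⟨θ, -, θ', -, rfl⟩)
  · exact Subalgebra.mul_mem _ (ι_mem_factorAlg (hL hq))
      (Subalgebra.mul_mem _ (ι_mem_factorAlg (hL hq')) (evenFactorAlg_le hx))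
  · exact Subalgebra.mul_mem _ (ι_mem_factorAlg (hL hq)) (contractLeft_mem_factorAlg θ (evenFactorAlg_le hx))
  · exact contractLeft_mem_factorAlg θ (contractLeft_mem_factorAlg θ' (evenFactorAlg_le hx))

/-- `⨆` over `Fin 3` is the triple `⊔`. [folklore] -/
theorem iSup_fin_three {α : Type*} [CompleteLattice α] (f : Fin 3 → α) : (⨆ i, f i) = f 0 ⊔ f 1 ⊔ f 2 :=
  le_antisymm (iSup_le fun i => by
      fin_cases i
      exacts [le_sup_of_le_left le_sup_left, le_sup_of_le_left le_sup_right, le_sup_right])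
    (sup_le (sup_le (le_iSup f 0) (le_iSup f 1)) (le_iSup f 2))

/-- **THEOREM (K_lin, degree ≤ 2, the count; th-7 FORMULA-N §N.3 in the literal contraction frame).** Over a splitting
`V = V₁ ⊕ V₂` (`V` finite-dimensional) with `Lᵢ ⊆ Vᵢ`, let `x₁ ∈ Λ^{even} V₁`, `x₂ ∈ Λ^{even} V₂` be factor classes each of
whose three factor spans `S²(xᵢ), S¹(xᵢ), K xᵢ` are independent. Then
`dim span(x₁ ∧ x₂) = dim S²(x₁)·dim K x₂ + dim S¹(x₁)·dim S¹(x₂) + dim K x₁·dim S²(x₂)` — «rank polynomials multiply»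
at `t²`. [cite: BourbakiAlgebre1a3, Ch. III §7 no. 7 (Prop. 10) and §11 no. 9] -/
theorem finrank_span_mul_eq [FiniteDimensional K V] (hV : IsCompl V₁ V₂) (hL₁ : L₁ ≤ V₁) (hL₂ : L₂ ≤ V₂)
    (hx₁ : x₁ ∈ evenFactorAlg V₁) (hx₂ : x₂ ∈ evenFactorAlg V₂)
    (hU : iSupIndep ![span (L₁ : Set V) (factorForms L₁ V₂) x₁, span₁ (L₁ : Set V) (factorForms L₁ V₂) x₁, K ∙ x₁])
    (hW : iSupIndep ![K ∙ x₂, span₁ (L₂ : Set V) (factorForms L₂ V₁) x₂, span (L₂ : Set V) (factorForms L₂ V₁) x₂]) :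
    Module.finrank K (span ((L₁ ⊔ L₂ : Submodule K V) : Set V) {θ : Module.Dual K V | ∀ q ∈ L₁ ⊔ L₂, θ q = 0} (x₁ * x₂)) =
      Module.finrank K (span (L₁ : Set V) (factorForms L₁ V₂) x₁) * Module.finrank K (K ∙ x₂) +
        Module.finrank K (span₁ (L₁ : Set V) (factorForms L₁ V₂) x₁) *
          Module.finrank K (span₁ (L₂ : Set V) (factorForms L₂ V₁) x₂) +
        Module.finrank K (K ∙ x₁) * Module.finrank K (span (L₂ : Set V) (factorForms L₂ V₁) x₂) := by
  haveI : FiniteDimensional K (ExteriorAlgebra K V) := finiteDimensional_exteriorAlgebra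
  have hUA : ∀ i, ![span (L₁ : Set V) (factorForms L₁ V₂) x₁, span₁ (L₁ : Set V) (factorForms L₁ V₂) x₁, K ∙ x₁] i ≤
      Subalgebra.toSubmodule (factorAlg V₁) := fun i => by
    fin_cases i
    exacts [span_le_factorAlg hL₁ hx₁, span₁_le_factorAlg hL₁ hx₁, span_singleton_le_factorAlg hx₁]
  have hWB : ∀ i, ![K ∙ x₂, span₁ (L₂ : Set V) (factorForms L₂ V₁) x₂, span (L₂ : Set V) (factorForms L₂ V₁) x₂] i ≤
      Subalgebra.toSubmodule (factorAlg V₂) := fun i => by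
    fin_cases i
    exacts [span_singleton_le_factorAlg hx₂, span₁_le_factorAlg hL₂ hx₂, span_le_factorAlg hL₂ hx₂]
  have h := finrank_iSup_mul_eq_sum (linearDisjoint_factorAlg hV) hUA hWB hU hW
  rw [iSup_fin_three, Fin.sum_univ_three] at h
  simp only [Matrix.cons_val_zero, Matrix.cons_val_one, Matrix.cons_val_two] at h
  rw [span_sup_mul_eq hV hL₁ hL₂ hx₁ hx₂]
  exact h

end KunnethCount

end ContractionSpan

end Summit.Ventures.HSemireg

end
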